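import Summits.QuantumFields.YangMills.Theorems.BalabanUVNodesKLCOfB7Prop5
import HarnessLib

/-!
# LOCATED VACUITY OF A HYPOTHESIS (no item refuted, no tree theorem refuted) — Q-37 in the kernel: `¬ B7.Prop5Printed (kexpOfRecord F N)` (`N ≥ 2`), i.e. [B7] Prop. 5 TYPED AT THE RECORD's FRAME-FREE chart is
# false, so the by-name (KL-C) door of ✓`…KLCOfB7Prop5` (`klC_of_B7Prop5Printed` ∕ `…_of_prop5Clause`) is kernel-true AND VACUOUS — ◆ CRIT-1 g39's Q-37 CUT «LOCATED: FALSE-AT-SCALE (J1′)» (nodeO STATUS l.5819), ★★★ №594∕№595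

Cell `pub-ymgap` ∕ `ym-nodeO-ideate`, porter hand `hand-27238-KLC` (g0); `--kind proof --supports stmt-QuantumFields-27238 --as helper`; count-neutral; 0 `def`.  [B7] = [Balaban1985Averaging]; [RG1] = [Balaban1987RG1].
Memo `Cruxes/Record13SepCoPHInhabitedAx/Lines/KLC-kexpOfRecord-hand.md` v1.3 §Q-37 (a); ★ PT-B g9's located finding (nodeO l.5767) and anchor `…C44IterMhCentreGaugeMode` (the all-orders identity; this file re-derives the
instance it needs from ✓`iterMh_gaugeSL` and does not import it).

THE PRINT vs THE RECORD.  [B7] (147) p.40 «|Q_k(U₀; c, b)| ≦ 1 + 2C′₁α₀», Prop. 5 (156) p.42 «|(δ∕δA_b)Q_k(U₀, ηA, c)| ≦ 1 + 2C′₁α₀ + C₃|A|» uniformly in `k`, for print's chart after the gauge fixing of Sect. C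
((58) p.27, (61)–(62) p.28, (64)–(69) p.29, (81) p.30; (139)–(141) p.39).  def-Y's `qCplxOp`∕`COfRecord`∕`CslOfRecord` are the FRAME-FREE chart `A ↦ (1∕i) log(Ū^k_h(e^{iη_kA}U₀)(c)(Ū^kU₀)(c)⋆)` on ALL of the
space (115), gauge directions included; the (0.4) averaging is gauge covariant with the coarse transformation = restriction to the `k`-block centres ([RG1] (0.6); ✓`C44IterMhGaugeCovariance.iterMh_gaugeSL`, exact).

THE WITNESS.  `U₀ = 1`, `A = 0`, `α₀ = α₁ = c₅`; `x₀ = embIter k y₀`, `λ = E₀₁ ∈ 𝔰𝔩(N, ℂ)`, `X_λ = λ` on the `d` bonds leaving `x₀`, `−λ` on the `d` arriving, `0` else.  §1: `e^{itX_λ}·1 = G_t • 1`, `G_t(x₀) = e^{itλ}`, so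
`Ū^k_h(e^{itX_λ})(⟨y₀, μ⟩) = e^{itλ}` and the frame-free `Q^{𝔰𝔩}_k(1, η·) := C^{𝔰𝔩} + Q_k(1)∘P` (the `qCplxOp` summands of `CslOfRecord` cancel BY DEFINITION; def-Y's displayed token «`fderiv C 0 = 0`» is not used) equals
`(1∕i) log e^{itλ} = tλ` along `t ↦ (t∕η_k)X_λ`.  §2 (J1′ pre-empted: the `fderiv` inside `dQk` IS the derivative — the chart is ℂ-differentiable at `0` by ✓`analyticAt_CslOfRecord_zero` + a continuous linear map, and the
directional value is obtained by the chain rule and uniqueness of derivatives): `D Q^{𝔰𝔩}_k(0)[X_λ](⟨y₀, μ⟩) = η_k·λ`; decomposing `X_λ` over the `≤ 2d` bonds at `x₀` (✓`sum_single115`) some entry has operator norm `≥ η_k∕(2d)`,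
i.e. `kexpOfRecord`'s `dQk 1 0 ≥ η_k^{−d}η_k∕(2d) = L^{3k}∕8` (`d = 4`), while the (156) conjunct at the index `(K := k, k; Ω = T; ⟨y₀, μ⟩; b)` demands `≤ 1 + 2C′₁c₅`; take `L^k > 8(1 + 2C′₁c₅) + 1`.

WHAT THIS FILE PROVES (0 def): `shift_ne_self`, `expOver_one_gaugeMode`, ★`iterMh_gaugeMode`, ★`chart_gaugeMode`, `kexpOfRecord_dQk` (`rfl`), `plaqDevEta_one`, ★★★`not_B7Prop5Printed_kexpOfRecord`.
HONEST FRAMING.  A NEGATIVE lemma about a TYPED INSTANCE (def-Y's chart ≠ [B7] Sect. C–D's chart); it refutes NOTHING in print ([B7] Prop. 5, [B11] Prop. 4 stand), refutes no tree theorem, touches no item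
(⟨stmt-QuantumFields-27238⟩ K0ᴬ 1∕2 unchanged); ✓`…KLCOfB7Prop5`'s theorems stay kernel-true implications from a refuted hypothesis — VACUOUS, never a by-name standing of K0ᴬ's row (c) (USE HELD, №594 (1)).  Road (not
here): (ρ-quot) print's Prop. 5 read on the hierarchical gauge slice, gated by Q-38B; (ρ-frame-min) plan B.  NODE O 0∕1; COUNT 8∕28 · K 1∕4 UNMOVED; finite `𝕋⁴_{L^K}` at fixed ε — NOT continuum ∕ OS; **the Yang–Mills mass gap
(Clay) is NOT proved by any of this.**  No `sorry`, `instance`, `notation`, `set_option`; standard axioms.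
-/

noncomputable section

open scoped Matrix Matrix.Norms.L2Operator InnerProductSpace ComplexConjugate BigOperators Topology
open Classical

namespace Summit.QuantumFields.YangMills.Theorems.KExpOfRecord

open Literature.MathematicalPhysics.QuantumFieldTheory.Balaban1983to89
open Literature.MathematicalPhysics.QuantumFieldTheory.Balaban1983to89.Node00
open T4Continuum BlockAveraging
open B9SectCLatticeCarrier (Bond)
open B11Eq115Space (NegSup NegSize JetSup levWeight)
open B11Eq90Transpose (single115 sum_single115)
open B11Eq90V0primeCurrent (flat115 flat115_apply)
open B11Eq111FrakG (nabla115)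
open B15AveragingHolomorphic (iterMh)
open B15DeterminingSets (embIter)
open MatrixLog (mlog)
open NormedSpace (exp)

variable {F : T4Family} {N : ℕ} [NeZero N] {K k : ℕ}

/-! ## §1  The one-site gauge mode at a block centre and the exact response of the frame-free chart -/

/-- A unit step moves a site (at least two sites per direction). [cite: Balaban1987RG1, (0.1) p.251 (bookkeeping)] -/
theorem shift_ne_self {j : ℕ} (x : Site (F.P K) j) (μ : Fin (F.P K).d) : x.shift μ ≠ x := by
  intro h
  have h1 := congrFun h μ
  simp only [Site.shift, Function.update_self] at h1
  haveI : Fact (1 < (F.P K).sitesPerDir j) := ⟨(F.P K).one_lt_sitesPerDir j⟩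
  exact one_ne_zero (add_eq_left.mp h1)

/-- **The chart field of the one-site gauge mode is a gauge transform of the flat field**: `e^{itX_λ(b)}·1 = G_t(b₋)·1·G_t(b₊)⁻¹`, `G_t(x₀) = e^{itλ}`, `G_t = 1` elsewhere.
[cite: Balaban1985Averaging, (11) p.19; Balaban1985Variational, (15) p.280] -/
theorem expOver_one_gaugeMode (x₀ : Site (F.P K) 0) (lam : Matrix (Fin N) (Fin N) ℂ) (t : ℂ) :
    expOver (1 : GaugeField (F.P K) 0 (SU N)) (fun b => t • (if b.src = x₀ then lam else if b.tgt = x₀ then -lam else 0)) =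
      fun b => (fun x : Site (F.P K) 0 => if x = x₀ then exp ((Complex.I * t) • lam) else 1) b.src * coeField (1 : GaugeField (F.P K) 0 (SU N)) b *
        ((fun x : Site (F.P K) 0 => if x = x₀ then exp ((Complex.I * t) • lam) else 1) b.tgt)⁻¹ := by
  funext b
  have h1 : coeField (1 : GaugeField (F.P K) 0 (SU N)) b = 1 := by rw [coeField_apply]; rfl
  rw [expOver_apply, h1, show ((1 : GaugeField (F.P K) 0 (SU N)) b : Matrix (Fin N) (Fin N) ℂ) = 1 from rfl]
  by_cases hs : b.src = x₀
  · have ht : b.tgt ≠ x₀ := by rw [← hs]; exact shift_ne_self b.src b.dir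
    simp only [hs, if_true, ht, if_false, inv_one, mul_one, smul_smul]
  · by_cases ht : b.tgt = x₀
    · simp only [hs, if_false, ht, if_true, one_mul, smul_neg, ← neg_smul, smul_smul, mul_one]
      rw [show (Complex.I * -t) • lam = -((Complex.I * t) • lam) by rw [mul_neg, neg_smul], Matrix.exp_neg]
    · simp only [hs, if_false, ht, smul_zero, NormedSpace.exp_zero, inv_one, mul_one]

/-- ★ **The exact response of the (0.4) averaging to the one-site gauge mode at a `k`-block centre**: `Ū^k_h(e^{itX_λ}·1)(⟨y₀, μ⟩) = e^{itλ}` (`x₀ = embIter k y₀`, `λ ∈ 𝔰𝔩(N, ℂ)`, `k ≤ m + K`).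
[cite: Balaban1987RG1, (0.6) p.253, (0.21) p.256; Balaban1985Averaging, (11) p.19] -/
theorem iterMh_gaugeMode (hk : k ≤ (F.P K).m + (F.P K).K) (y₀ : Site (F.P K) k) (μ : Fin (F.P K).d) {lam : Matrix (Fin N) (Fin N) ℂ} (hlam : lam.trace = 0) (t : ℂ) :
    iterMh k (expOver (1 : GaugeField (F.P K) 0 (SU N)) (fun b => t • (if b.src = embIter k y₀ then lam else if b.tgt = embIter k y₀ then -lam else 0))) ⟨y₀, μ⟩ =
      exp ((Complex.I * t) • lam) := by
  rw [expOver_one_gaugeMode]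
  have hG : ∀ x : Site (F.P K) 0, ((fun x : Site (F.P K) 0 => if x = embIter k y₀ then exp ((Complex.I * t) • lam) else 1) x).det = 1 := by
    intro x
    dsimp only
    split_ifs
    · exact B13Inv214OrbitSUN.det_exp_smul_of_trace_eq_zero hlam _
    · exact Matrix.det_one
  rw [C44IterMh.iterMh_gaugeSL _ hG _ k, iterMh_coeField_of_smallBelow F N k 1 (smallBelow_avOfRecord_one F N k), B15Claim189UnitTestAtRecord.iter_avOfRecord_one F N K k]
  have htgt : embIter k (PBond.tgt ⟨y₀, μ⟩) ≠ embIter k y₀ := by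
    intro h
    have h' := congrArg (B14.Eq22Determines.blockIter k) h
    rw [B15Eq177GaugeInvariance.blockIter_embIter k hk, B15Eq177GaugeInvariance.blockIter_embIter k hk] at h'
    exact shift_ne_self y₀ μ h'
  have hone : coeField (1 : GaugeField (F.P K) k (SU N)) ⟨y₀, μ⟩ = 1 := by rw [coeField_apply]; rfl
  simp only [if_true, if_neg htgt, inv_one, mul_one, hone]

variable [Fact (0 < (F.L : ℝ))] [Fact (0 < (F.P K).eta k)]

/-- ★ **The frame-free chart along the gauge curve**: for `Q^{𝔰𝔩}_k(1, η·) := C^{𝔰𝔩} + Q_k(1)∘P` and a field `X` of the space (115) reading `X_λ`, `Q^{𝔰𝔩}_k(1, η·((t∕η_k)·X))(⟨y₀, μ⟩) = (1∕i)·log(e^{itλ})`.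
[cite: Balaban1985Averaging, (127) p.37, (134) p.38; Balaban1985Variational, (44) p.285; Balaban1987RG1, (0.6) p.253] -/
theorem chart_gaugeMode (hk : k ≤ (F.P K).m + (F.P K).K) (Ω : ℕ → Set (Site (F.P K) 0)) (levB : PBond (F.P K) k → ℕ) (y₀ : Site (F.P K) k) (μ : Fin (F.P K).d)
    {lam : Matrix (Fin N) (Fin N) ℂ} (hlam : lam.trace = 0) {X : Space115Lit F N K k Ω 1}
    (hX : JetSup.equiv _ _ (nabla115 ((F.P K).eta k) (unitsOfRecord F N (1 : GaugeField (F.P K) 0 (SU N)))) X =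
      fun bb => (fun b : PBond (F.P K) 0 => if b.src = embIter k y₀ then lam else if b.tgt = embIter k y₀ then -lam else 0) ((bondToLit (F.P K) 0).symm bb)) (t : ℂ) :
    NegSup.equiv (levWeight (F.L : ℝ) ((F.P K).eta k) levB 0) (Matrix (Fin N) (Fin N) ℂ)
      (CslOfRecord F N K k Ω 1 levB ((t * ((((F.P K).eta k : ℝ) : ℂ))⁻¹) • X) +
        (NegSup.equiv (levWeight (F.L : ℝ) ((F.P K).eta k) levB 0) (Matrix (Fin N) (Fin N) ℂ)).symm
          (qCplxOp k (1 : GaugeField (F.P K) 0 (SU N)) (evLit F N K k Ω 1 (slProjLit F N K k Ω 1 ((t * ((((F.P K).eta k : ℝ) : ℂ))⁻¹) • X))))) ⟨y₀, μ⟩ =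
      (Complex.I⁻¹ : ℂ) • mlog (exp ((Complex.I * t) • lam)) := by
  set s : ℂ := t * ((((F.P K).eta k : ℝ) : ℂ))⁻¹ with hs
  have htr : ∀ bb, (JetSup.equiv _ _ (nabla115 ((F.P K).eta k) (unitsOfRecord F N (1 : GaugeField (F.P K) 0 (SU N)))) (s • X) bb).trace = 0 := by
    intro bb
    rw [JetSup.equiv_smul, Pi.smul_apply, Matrix.trace_smul, hX]
    dsimp only
    split_ifs <;> simp [hlam]
  rw [slProjLit_of_trace_eq_zero F N K k Ω 1 htr, CslOfRecord_apply, slProjLit_of_trace_eq_zero F N K k Ω 1 htr, NegSup.equiv_add, Equiv.apply_symm_apply,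
    Pi.add_apply, COfRecord_apply, sub_add_cancel]
  have hη : ((((F.P K).eta k : ℝ) : ℂ)) ≠ 0 := by exact_mod_cast (ne_of_gt (Fact.out : 0 < (F.P K).eta k))
  have hfield : ((((F.P K).eta k : ℝ) : ℂ)) • evLit F N K k Ω 1 (s • X) =
      fun b => t • (if b.src = embIter k y₀ then lam else if b.tgt = embIter k y₀ then -lam else 0) := by
    funext b
    rw [Pi.smul_apply, map_smul, Pi.smul_apply, evLit_apply, hX]
    dsimp only
    rw [Equiv.symm_apply_apply, smul_smul, hs, ← mul_assoc, mul_comm _ t, mul_assoc, mul_inv_cancel₀ hη, mul_one]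
  rw [hfield, iterMh_gaugeMode hk y₀ μ hlam t, B15Claim189UnitTestAtRecord.iter_avOfRecord_one F N K k,
    show ((1 : GaugeField (F.P K) k (SU N)) ⟨y₀, μ⟩ : Matrix (Fin N) (Fin N) ℂ) = 1 from rfl, star_one, mul_one]

/-! ## §2  The refutation -/

omit [Fact (0 < (F.L : ℝ))] [Fact (0 < (F.P K).eta k)] in
/-- Unfolding of the `dQk` field of `kexpOfRecord` (`rfl`). [cite: Balaban1985Averaging, (156) p.42, (138) p.39 (bookkeeping)] -/
theorem kexpOfRecord_dQk (i : KRecIdx F) (U₀ : GaugeField (F.P i.K) 0 (SU N)) (A : Bond (F.P i.K).d (fun _ => (F.P i.K).sitesPerDir 0) → Matrix (Fin N) (Fin N) ℂ) :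
    haveI : Fact (0 < (F.L : ℝ)) := factL F
    haveI : Fact (0 < (F.P i.K).eta i.k) := factEta F i.K i.k
    (kexpOfRecord F N i).dQk U₀ A =
      ((F.P i.K).eta i.k ^ (F.P i.K).d)⁻¹ *
        ‖(NegSup.evalCLM ℂ (levWeight (F.L : ℝ) ((F.P i.K).eta i.k) i.levB 0) i.c).comp
          ((fderiv ℂ
              (fun A' : Space115Lit F N i.K i.k i.Ω U₀ =>
                CslOfRecord F N i.K i.k i.Ω U₀ i.levB A' +
                  (NegSup.equiv (levWeight (F.L : ℝ) ((F.P i.K).eta i.k) i.levB 0) (Matrix (Fin N) (Fin N) ℂ)).symm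
                    (qCplxOp i.k U₀ (evLit F N i.K i.k i.Ω U₀ (slProjLit F N i.K i.k i.Ω U₀ A'))))
              ((JetSup.equiv (levWeight (F.L : ℝ) ((F.P i.K).eta i.k) (bondLevLit F i.Ω i.k) 1) (levWeight (F.L : ℝ) ((F.P i.K).eta i.k) (pairLevLit F i.Ω i.k) 2)
                (nabla115 ((F.P i.K).eta i.k) (unitsOfRecord F N U₀))).symm A)).comp
            (single115 (lev₁ := pairLevLit F i.Ω i.k) (Dc := nabla115 ((F.P i.K).eta i.k) (unitsOfRecord F N U₀)) i.b))‖ := rfl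

omit [Fact (0 < (F.L : ℝ))] [Fact (0 < (F.P K).eta k)] in
/-- At the flat background every plaquette variable is `1`: the (52)-deviation vanishes. [cite: Balaban1985Averaging, (52) p.26 (bookkeeping)] -/
theorem plaqDevEta_one (i : KRecIdx F) : (kexpOfRecord F N i).plaqDevEta (1 : GaugeField (F.P i.K) 0 (SU N)) = 0 := by
  rw [kexpOfRecord_plaqDevEta]
  have h1 : ∀ p : Plaq (F.P i.K) 0, dist1 (GaugeField.plaqHol (1 : GaugeField (F.P i.K) 0 (SU N)) p) = 0 := by
    intro p
    simp only [GaugeField.plaqHol, show (1 : GaugeField (F.P i.K) 0 (SU N)) = fun _ => 1 from rfl, mul_one, inv_one, GaugeGroup.dist1_one]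
  simp only [h1, Real.iSup_const_zero, mul_zero]

omit [Fact (0 < (F.L : ℝ))] [Fact (0 < (F.P K).eta k)] in
variable (F N) in
/-- ★★★ **[B7] PROP. 5 TYPED AT THE RECORD's FRAME-FREE CHART IS FALSE** (`N ≥ 2`): the displayed hypothesis `B7.Prop5Printed (kexpOfRecord F N)` is refuted by its (156) conjunct at `U₀ = 1`, `A = 0`
through the exact one-site gauge-mode response (module docstring).  Located VACUITY of a hypothesis: ✓`klC_of_B7Prop5Printed` and every by-name use of it are vacuous; nothing in print is refuted.
[cite: Balaban1985Averaging, Proposition 5 (156)–(157) p.42, (147) p.40, (138) p.39, (58) p.27, (64)–(69) p.29, (81) p.30; Balaban1987RG1, (0.6) p.253] -/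
theorem not_B7Prop5Printed_kexpOfRecord (hN : 2 ≤ N) : ¬ B7.Prop5Printed (kexpOfRecord F N) := by
  rintro ⟨C₁', C₃, c₅, hC₁', -, hc₅, h⟩
  haveI : Fact (0 < (F.L : ℝ)) := factL F
  -- the traceless direction `λ = E₀₁` and the scale `k`
  have h01 : (⟨0, by omega⟩ : Fin N) ≠ ⟨1, by omega⟩ := by simp [Fin.ext_iff]
  set lam : Matrix (Fin N) (Fin N) ℂ := Matrix.single (⟨0, by omega⟩ : Fin N) ⟨1, by omega⟩ 1 with hlamdef
  have hlam : lam.trace = 0 := Matrix.trace_single_eq_of_ne _ _ _ h01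
  have hlampos : 0 < ‖lam‖ := by
    refine norm_pos_iff.mpr fun h0 => one_ne_zero (α := ℂ) ?_
    have := congrFun (congrFun h0 ⟨0, by omega⟩) ⟨1, by omega⟩
    rwa [hlamdef, Matrix.single_apply_same] at this
  set B : ℝ := 1 + 2 * C₁' * c₅ with hB
  have hBpos : 0 < B := by positivity
  obtain ⟨k, hk⟩ := pow_unbounded_of_one_lt (8 * B + 1) (by exact_mod_cast F.hL.2 : (1 : ℝ) < (F.L : ℝ))
  haveI : Fact (0 < (F.P k).eta k) := factEta F k k
  have hkm : k ≤ (F.P k).m + (F.P k).K := by rw [T4Family.P_K]; omega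
  set Ω : ℕ → Set (Site (F.P k) 0) := fun _ => Set.univ
  set levB : PBond (F.P k) k → ℕ := fun _ => 0
  set y₀ : Site (F.P k) k := fun _ => 0
  set μ : Fin (F.P k).d := ⟨0, by rw [T4Family.P_d]; norm_num⟩
  set c : PBond (F.P k) k := ⟨y₀, μ⟩
  set x₀ : Site (F.P k) 0 := embIter k y₀ with hx₀
  set Xrec : PBond (F.P k) 0 → Matrix (Fin N) (Fin N) ℂ := fun b => if b.src = embIter k y₀ then lam else if b.tgt = embIter k y₀ then -lam else 0 with hXrec
  set wB := levWeight (F.L : ℝ) ((F.P k).eta k) levB 0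
  set Dc := nabla115 ((F.P k).eta k) (unitsOfRecord F N (1 : GaugeField (F.P k) 0 (SU N)))
  set X : Space115Lit F N k k Ω 1 := (JetSup.equiv (levWeight (F.L : ℝ) ((F.P k).eta k) (bondLevLit F Ω k) 1) (levWeight (F.L : ℝ) ((F.P k).eta k) (pairLevLit F Ω k) 2) Dc).symm
    (fun bb => Xrec ((bondToLit (F.P k) 0).symm bb)) with hXdef
  have hX : JetSup.equiv _ _ Dc X = fun bb => Xrec ((bondToLit (F.P k) 0).symm bb) := by rw [hXdef, Equiv.apply_symm_apply]
  set Φ : Space115Lit F N k k Ω 1 → NegSize (F.L : ℝ) ((F.P k).eta k) levB 0 (Matrix (Fin N) (Fin N) ℂ) := fun A' =>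
    CslOfRecord F N k k Ω 1 levB A' + (NegSup.equiv wB (Matrix (Fin N) (Fin N) ℂ)).symm (qCplxOp k 1 (evLit F N k k Ω 1 (slProjLit F N k k Ω 1 A'))) with hΦ
  set ηc : ℂ := (((F.P k).eta k : ℝ) : ℂ) with hηc
  have hηpos : 0 < (F.P k).eta k := Fact.out
  have hηc0 : ηc ≠ 0 := by rw [hηc]; exact_mod_cast hηpos.ne'
  -- (i) the chart is differentiable at `0` (analytic `C^{sl}` + a continuous linear map)
  set Lc : Space115Lit F N k k Ω 1 →L[ℂ] NegSize (F.L : ℝ) ((F.P k).eta k) levB 0 (Matrix (Fin N) (Fin N) ℂ) :=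
    (NegSup.continuousLinearEquiv ℂ (V := Matrix (Fin N) (Fin N) ℂ) wB).symm.toContinuousLinearMap.comp
      (LinearMap.toContinuousLinearMap ((qCplxOp k (1 : GaugeField (F.P k) 0 (SU N))).comp ((evLit F N k k Ω 1).comp (slProjLit F N k k Ω 1).toLinearMap)))
  have hΦd : DifferentiableAt ℂ Φ 0 := by
    rw [show Φ = fun A' => CslOfRecord F N k k Ω 1 levB A' + Lc A' from funext fun A' => rfl]
    exact ((analyticAt_CslOfRecord_zero F N k k Ω 1 levB (smallBelow_avOfRecord_one F N k)).differentiableAt).add Lc.differentiableAt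
  -- (ii) the two derivatives of `t ↦ Φ((t/η)X)(c)`
  set γ : ℂ → Space115Lit F N k k Ω 1 := fun t => (t * ηc⁻¹) • X with hγ
  have hγ' : HasDerivAt γ (ηc⁻¹ • X) 0 := by
    have h2 := ((hasDerivAt_id (0 : ℂ)).mul_const ηc⁻¹).smul_const X
    rw [one_mul] at h2
    exact h2
  set g : ℂ → Matrix (Fin N) (Fin N) ℂ := fun t => NegSup.evalCLM ℂ wB c (Φ (γ t))
  have hg1 : HasDerivAt g (NegSup.evalCLM ℂ wB c (fderiv ℂ Φ 0 (ηc⁻¹ • X))) 0 := by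
    have hΦ' : HasFDerivAt Φ (fderiv ℂ Φ 0) (γ 0) := by rw [show γ 0 = 0 by rw [hγ]; simp]; exact hΦd.hasFDerivAt
    exact (NegSup.evalCLM ℂ wB c).hasFDerivAt.comp_hasDerivAt 0 (hΦ'.comp_hasDerivAt 0 hγ')
  have hg2 : HasDerivAt g lam 0 := by
    have hlin : HasDerivAt (fun t : ℂ => t • lam) lam 0 := by simpa using (hasDerivAt_id (0 : ℂ)).smul_const lam
    have hε : 0 < Real.log 2 / (‖lam‖ + 1) := div_pos (Real.log_pos (by norm_num)) (by positivity)
    refine hlin.congr_of_eventuallyEq (Metric.eventually_nhds_iff.2 ⟨Real.log 2 / (‖lam‖ + 1), hε, fun t ht => ?_⟩)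
    rw [show g t = (Complex.I⁻¹ : ℂ) • mlog (exp ((Complex.I * t) • lam)) from chart_gaugeMode hkm Ω levB y₀ μ hlam hX t]
    have hsmall : ‖(Complex.I * t) • lam‖ < Real.log 2 := by
      rw [norm_smul, norm_mul, Complex.norm_I, one_mul]
      rw [dist_zero_right] at ht
      calc ‖t‖ * ‖lam‖ ≤ (Real.log 2 / (‖lam‖ + 1)) * ‖lam‖ := mul_le_mul_of_nonneg_right ht.le (norm_nonneg _)
        _ < Real.log 2 / (‖lam‖ + 1) * (‖lam‖ + 1) := mul_lt_mul_of_pos_left (lt_add_one _) hε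
        _ = Real.log 2 := div_mul_cancel₀ _ (by positivity)
    rw [B7BlockAvgLog.mlog_exp hsmall, smul_smul, ← mul_assoc, inv_mul_cancel₀ Complex.I_ne_zero, one_mul]
  have hD : NegSup.evalCLM ℂ wB c (fderiv ℂ Φ 0 X) = ηc • lam := by
    have huniq := hg1.unique hg2
    rw [map_smul, map_smul] at huniq
    simpa only [smul_smul, mul_inv_cancel₀ hηc0, one_smul] using congrArg (fun Z => ηc • Z) huniq
  -- (iii) decomposition over the fine bonds; pigeonhole over the `≤ 2d` bonds at `x₀`
  set T : Bond (F.P k).d (fun _ => (F.P k).sitesPerDir 0) → (Matrix (Fin N) (Fin N) ℂ →L[ℂ] Matrix (Fin N) (Fin N) ℂ) :=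
    fun bb => (NegSup.evalCLM ℂ wB c).comp ((fderiv ℂ Φ 0).comp (single115 (lev₁ := pairLevLit F Ω k) (Dc := Dc) bb)) with hT
  have hsum : ∑ bb, T bb (flat115 X bb) = ηc • lam := by
    have hs := sum_single115 (lev₁ := pairLevLit F Ω k) (Dc := Dc) X
    have : ∑ bb, T bb (flat115 X bb) = NegSup.evalCLM ℂ wB c (fderiv ℂ Φ 0 (∑ bb, single115 (lev₁ := pairLevLit F Ω k) (Dc := Dc) bb (flat115 X bb))) := by
      rw [map_sum, map_sum]
      rfl
    rw [this, hs, hD]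
  set S : Finset (Bond (F.P k).d (fun _ => (F.P k).sitesPerDir 0)) :=
    Finset.univ.filter (fun bb => ((bondToLit (F.P k) 0).symm bb).src = x₀ ∨ ((bondToLit (F.P k) 0).symm bb).tgt = x₀) with hS
  have hbound : ∀ bb, ‖T bb (flat115 X bb)‖ ≤ if bb ∈ S then ‖T bb‖ * ‖lam‖ else 0 := by
    intro bb
    rw [flat115_apply, hX]
    by_cases hbb : bb ∈ S
    · rw [if_pos hbb]
      refine (ContinuousLinearMap.le_opNorm _ _).trans (mul_le_mul_of_nonneg_left ?_ (norm_nonneg _))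
      rw [hXrec]; dsimp only
      split_ifs
      · exact le_rfl
      · rw [norm_neg]
      · rw [norm_zero]; exact norm_nonneg _
    · rw [if_neg hbb]
      have h1 : ¬ (((bondToLit (F.P k) 0).symm bb).src = x₀) := fun h' => hbb (by rw [hS, Finset.mem_filter]; exact ⟨Finset.mem_univ _, Or.inl h'⟩)
      have h2 : ¬ (((bondToLit (F.P k) 0).symm bb).tgt = x₀) := fun h' => hbb (by rw [hS, Finset.mem_filter]; exact ⟨Finset.mem_univ _, Or.inr h'⟩)
      rw [hXrec]; dsimp only
      rw [hx₀] at h1 h2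
      rw [if_neg h1, if_neg h2, map_zero, norm_zero]
  have hcard : S.card ≤ 2 * (F.P k).d := by
    set f : Fin (F.P k).d × Bool → Bond (F.P k).d (fun _ => (F.P k).sitesPerDir 0) :=
      fun p => if p.2 then bondToLit (F.P k) 0 ⟨x₀, p.1⟩ else bondToLit (F.P k) 0 ⟨x₀.unshift p.1, p.1⟩ with hf
    have hsub : S ⊆ Finset.univ.image f := by
      intro bb hbb
      rw [hS, Finset.mem_filter] at hbb
      rw [Finset.mem_image]
      rcases hbb.2 with h' | h'
      · refine ⟨(((bondToLit (F.P k) 0).symm bb).dir, true), Finset.mem_univ _, ?_⟩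
        rw [hf]; dsimp only; rw [if_pos rfl, ← h']
        exact Equiv.apply_symm_apply _ _
      · refine ⟨(((bondToLit (F.P k) 0).symm bb).dir, false), Finset.mem_univ _, ?_⟩
        have hsrc : x₀.unshift ((bondToLit (F.P k) 0).symm bb).dir = ((bondToLit (F.P k) 0).symm bb).src := by
          rw [← h']; exact B10StarCount.unshift_shift _ _
        rw [hf]; dsimp only; rw [if_neg Bool.false_ne_true, hsrc]
        exact Equiv.apply_symm_apply _ _
    calc S.card ≤ (Finset.univ.image f).card := Finset.card_le_card hsub
      _ ≤ (Finset.univ : Finset (Fin (F.P k).d × Bool)).card := Finset.card_image_le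
      _ = 2 * (F.P k).d := by rw [Finset.card_univ, Fintype.card_prod, Fintype.card_fin, Fintype.card_bool, mul_comm]
  have hηle : (F.P k).eta k ≤ ∑ bb ∈ S, ‖T bb‖ := by
    refine le_of_mul_le_mul_right ?_ hlampos
    calc (F.P k).eta k * ‖lam‖ = ‖∑ bb, T bb (flat115 X bb)‖ := by rw [hsum, norm_smul, hηc, Complex.norm_real, Real.norm_of_nonneg hηpos.le]
      _ ≤ ∑ bb, ‖T bb (flat115 X bb)‖ := norm_sum_le _ _
      _ ≤ ∑ bb, (if bb ∈ S then ‖T bb‖ * ‖lam‖ else 0) := Finset.sum_le_sum fun bb _ => hbound bb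
      _ = (∑ bb ∈ S, ‖T bb‖) * ‖lam‖ := by rw [← Finset.sum_filter, Finset.filter_mem_eq_inter, Finset.univ_inter, Finset.sum_mul]
  have hSne : S.Nonempty := by
    by_contra hne
    rw [Finset.not_nonempty_iff_eq_empty] at hne
    rw [hne, Finset.sum_empty] at hηle
    exact absurd hηle (not_le.mpr hηpos)
  obtain ⟨bb, -, hbb⟩ : ∃ bb ∈ S, (F.P k).eta k / S.card ≤ ‖T bb‖ := by
    refine Finset.exists_le_of_sum_le hSne ?_
    rwa [Finset.sum_const, nsmul_eq_mul, mul_div_cancel₀ _ (by exact_mod_cast hSne.card_pos.ne')]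
  have hentry : (F.P k).eta k / (2 * (F.P k).d) ≤ ‖T bb‖ :=
    (div_le_div_of_nonneg_left hηpos.le (by exact_mod_cast hSne.card_pos) (by exact_mod_cast hcard)).trans hbb
  -- (iv) the (156) clause at the index `(k, k; c; bb)`, `U₀ = 1`, `A = 0`, `α₀ = α₁ = c₅`
  have h0 : (kexpOfRecord F N ⟨k, k, hkm, Ω, levB, c, bb⟩).fldNorm (0 : Bond (F.P k).d (fun _ => (F.P k).sitesPerDir 0) → Matrix (Fin N) (Fin N) ℂ) = 0 := by
    rw [kexpOfRecord_fldNorm, norm_zero]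
  have h156 := (h ⟨k, k, hkm, Ω, levB, c, bb⟩ c₅ c₅ hc₅ le_rfl hc₅ le_rfl (1 : GaugeField (F.P k) 0 (SU N)) (by rw [plaqDevEta_one]; exact hc₅)
    (0 : Bond (F.P k).d (fun _ => (F.P k).sitesPerDir 0) → Matrix (Fin N) (Fin N) ℂ) (by rw [h0]; exact hc₅)).1
  rw [kexpOfRecord_dQk, h0, mul_zero, add_zero] at h156
  change ((F.P k).eta k ^ (F.P k).d)⁻¹ * ‖T bb‖ ≤ 1 + 2 * C₁' * c₅ at h156
  -- (v) arithmetic: `η^{−d}·η/(2d) = L^{3k}/8 > B`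
  set M : ℝ := (F.L : ℝ) ^ k with hM
  have hηM : (F.P k).eta k = M⁻¹ := by rw [Params.eta, T4Family.P_L, inv_pow]
  have hM1 : 1 ≤ M := by have : (8 * B + 1 : ℝ) < M := hk; linarith
  have hlow : M / 8 ≤ ((F.P k).eta k ^ (F.P k).d)⁻¹ * ‖T bb‖ := by
    refine le_trans ?_ (mul_le_mul_of_nonneg_left hentry (by positivity))
    rw [T4Family.P_d F k, hηM]
    push_cast
    rw [inv_pow, inv_inv, show M ^ 4 * (M⁻¹ / (2 * 4)) = M ^ 3 / 8 by field_simp; ring]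
    have hM3 : M ≤ M ^ 3 := le_self_pow₀ hM1 (by norm_num)
    linarith
  have hk' : (8 * B + 1 : ℝ) < M := hk
  linarith [hlow.trans h156]

end Summit.QuantumFields.YangMills.Theorems.KExpOfRecord

end
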